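import Summits.BirchSwinnertonDyer.BirchSwinnertonDyer.Theses.PrintX6
import Summits.BirchSwinnertonDyer.Rank1Residual.X4.KuriharaLowerHalf
import Summits.BirchSwinnertonDyer.BirchSwinnertonDyer.Theorems.PrintX6EisensteinHalfFiveLeRestKimDeficitLevelCertificate
import Literature.NumberTheory.EllipticCurves.KuriharaNumberInvariants
import HarnessLib

/-!
# Line `kim-deficit` — crux `EisensteinHalfFiveLeRest` (route PrintX6, item stmt-BirchSwinnertonDyer-21116,
# rank 211): the Eisenstein (lower) half `ord_p #Ш_an ≤ ord_p #Ш` on X6 ∧ `r_an = 0` ∧ `p ≥ 5` OFF the erratum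
# sub-locus, read off ONE Kurihara number of depth `t + 1`, `t = ord_p ∏ c_ℓ` — C.-H. Kim's structure theorem
# (Amer. J. Math. 148 (2026) Thm. 1.8 (6), PUBLISHED, any reduction type, no main conjecture, no `±` theory,
# no auxiliary imaginary quadratic field, no Eisenstein series).  NEAR-MISS SHAPE: Kim's theorem computes
# `ord_p #Ш(E)(p) ≥ ord_p (L(E,1)/Ω_E) − (k − 1)` from any Kurihara number `δ̃_n ≢ 0 (mod p^k)`; the crux needs
# exactly `k − 1 ≤ t`; the MEASURED DEFICIT of the argument is `∂^(∞)(δ̃) − t ≥ 0` and the SINGLE INPUT to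
# improve is the class-wide inequality `∂^(∞)(δ̃) ≤ t` on X6-Rest (the `≤` half of Kim's Conjecture 1.9 /
# arXiv Conj. 1.10 there) — stub `stub_partialInfty_le_tamagawa_X6Rest`.

HONEST FRAMING (D-0152 / W-71): this line feeds the CLASS route PrintX6 (leaf `WAllCornerX6r0`); BSD is not
proved by any of this; stubs 2–3 below are `sorry` (stub 1 is closed by name); the composition `EisensteinHalfFiveLeRest_of` only shows —
kernel-checked — that the three stub STATEMENTS give the crux BY NAME, and `EisensteinHalfFiveLeRest_of_stubs`
that the registered stubs have literally those statements.  For the CLASS the hard stub is, by Kim's own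
equivalences, the Kato-side face of the same wall (rank-`0` main conjecture at the trivial character at a
supersingular prime); what the line buys is stated, not hidden: a preprint-free, refereed ENGINE (contrast: the
parked line `all_inert` needs BLV Step 4 = Wan's `±` converse, unrefereed), a per-pair DECIDABLE certificate
(2 of the 6 Rest census cells already carry one in the tree: `12927e1 @ 7`, `t = 0`, unit number —
`KuriharaRecords.cert_X6_12927e1_p7`; `399190l1 @ 7`, `t = 1`, `δ̃⁽²⁾_{6763·23227} ≡ ±21 (mod 49)` —
`bsdp_x6r0tam_399190l1_7`; the other four, `138594b1, 246697a1, 321518d1, 331554a1 @ 5`, all `t = 0`, are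
OFFERED with computed two-prime levels, `X6KuriharaOfferRecords*`), and a hard stub that is one typed
inequality, conductor-blind and strictly more concrete than the crux.

STATE (revision 2, x6-p2 LEAD g3, 2026-08-28T06:45Z; registered stubs = {stub 2, stub 3}):
* stub 1 `stub_levelCertificate_of_partialInfty_le` — CLOSED BY NAME (seat x6-p2-w2 g2, p608466,
  `Theorems/PrintX6EisensteinHalfFiveLeRestKimDeficitLevelCertificate.lean`); below it is the sorry-free lemma
  `levelCertificate_of_partialInfty_le` (the landed theorem, re-exported; no longer a stub).
* stub 2 `stub_missingLowerBoundAt_of_levelCertificate_X6` — as REGISTERED (no fact binder) it is provable only modulo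
  the named facts its engine runs on, so it STAYS a registered `sorry` here; its closers modulo named facts are LANDED:
  `Theorems/…KimDeficitEngine.lean` (w2 g2, p608837: `PublishedInputsX6 →` Kim 2026 Thm 1.8 (6) literal fact `→` displayed
  Manin supply `→` stub-2 text), `Theorems/…KimDeficitManinDatum.lean` (LEAD g3, p609432: the Manin supply `p ∤ c_D` from
  Mazur 1978 Cor 4.1 = route item `InputMazurManinOdd`, by prime-to-`p` isogeny transport) and
  `Theorems/…KimDeficitEngineKimTwin.lean` (LEAD g3, p610149: stub-2 text from the PROOF-COVERED `(t0)` twin of Kim (6) +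
  `InputMazurManinOdd` + `PublishedInputsX6`; and `eisensteinHalfFiveLeRest_of_publishedInputsX6_of_kimTwin_of_stub3` :
  `PublishedInputsX6 → InputMazurManinOdd → KimTwin → STUB 3 → crux`).  The skeleton is NOT reshaped to carry these
  antecedents because `#h21_check_skeleton` admits only tagged obligations as hypotheses of the composing theorem and
  Kim 2026 Thm 1.8 (6) is not (yet) an item of any route — TURNKEY to the planner: file it (its `(t0)` twin) as an Input
  item of PrintX6, then stub 2 re-registers as `Inputs → text` and closes by name.
* stub 3 `stub_partialInfty_le_tamagawa_X6Rest` — OPEN, the hard stub; NO prover by director ROW 6 RULING (154)(b)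
  (class-wide ≡ Kato IMC face of the crux); per pair DECIDABLE.

Stubs (3, as filed by bsd-idea-8 g2):
* `stub_levelCertificate_of_partialInfty_le` — PROVABLE NOW (definitions only, size M): `∂^(∞)(δ̃) ≤ t` in `ℕ∞`
  unwinds (the infimum over cyclic Kolyvagin levels is attained in the well-order `ℕ∞`; `¬ KuriharaDivisibleAt n (t+1)`)
  to an explicit certificate: a level `n ∈ 𝒩_k`, `1 ≤ k ≤ t + 1`, cyclic reductions, surjective discrete
  logarithms `ψ`, `kuriharaNumber f (p^k) n ψ ≠ 0` (`k = 0` is excluded because `ℤ/p^0` is trivial).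
* `stub_missingLowerBoundAt_of_levelCertificate_X6` — ENGINE, closable modulo NAMED REFEREED facts only
  (conditional-result): Kim 2026 Thm. 1.8 (6) = tree fact `Kim2026.rankZero_le_padicValNat_sha_of_kuriharaNumber_ne_zero`;
  GZK `rank_eq_analyticRank_of_analyticRank_le_one`; modularity `exists_isNewformOf` / `hasEntireLFunction_rat`;
  the period transfer `realPeriodRat_eq_unit_mul_plusPeriod` (Greenberg–Vatsal Rem. 3.4 + Mazur / Abbes–Ullmo:
  `p ∤ c_D` at a good `p ≥ 5`); a modular parametrisation datum (`nonempty_modularParametrizationData_of_eichlerShimura`);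
  and the tree THEOREMS `X4.missingLowerBoundAt_rankZero_of_kimLower` (generic in the class, despite its
  namespace) / `X6RankZero.bsdp_of_kimLower_of_prop48` (its X6 specialisation, whose lower half is what we use);
  surj(p) is automatic on X6 at `p ≠ 2` (`ClassX6.surj`), `L(E,1) ≠ 0` from `r_an = 0`.
* `stub_partialInfty_le_tamagawa_X6Rest` — THE HARD STUB (class-wide, open): on X6 ∧ ¬CM ∧ `p ≥ 5` ∧ `r_an = 0`
  ∧ ¬`HasErratumPrime`, for the newform `f` of `W`, `kuriharaPartialInfty W p f ≤ ord_p ∏ c_ℓ`.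

Composition: `EisensteinHalfFiveLeRest_of : S1 → S2 → S3 → EisensteinHalfFiveLeRest` (for each pair: S3 gives the
`ℕ∞` bound, S1 the certificate, S2 the lower half `Typed.MissingLowerBoundAt W p`, and the crux's conclusion is
that lower half with the rational value of `#Ш_an` identified by injectivity of `ℚ → ℂ`).
-/

set_option autoImplicit false

noncomputable section

open scoped Classical MatrixGroups ModularForm

open CongruenceSubgroup WeierstrassCurve Literature.NumberTheory.EllipticCurves
  Literature.NumberTheory.EllipticCurves.ModularForms
  Literature.NumberTheory.EllipticCurves.Rank1Residual
  Literature.NumberTheory.EllipticCurves.Rank1Residual.Typed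
  Summit.BirchSwinnertonDyer.Rank1Residual.Supersingular

namespace Summit.BirchSwinnertonDyer.BirchSwinnertonDyer.Cruxes.EisensteinHalfFiveLeRest.KimDeficit

/-! ### The stubs (stub 1 closed by name; stubs 2 and 3 registered) -/

/-- Former STUB 1 — CLOSED BY NAME (p608466, `Theorems.PrintX6.KimDeficit.stub_levelCertificate_of_partialInfty_le`,
seat x6-p2-w2 g2): a finite value `∂^(∞)(δ̃) ≤ t` of Kim's invariant is WITNESSED by one explicit certificate of level
`k ≤ t + 1` (cyclic Kolyvagin level `n ∈ 𝒩_k(E,p)`, surjective `ψ_ℓ`, `kuriharaNumber f (p^k) n ψ ≠ 0`).  Re-exported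
here sorry-free under a non-stub name so the skeleton's composition consumes the landed theorem.
[cite: Kim2022StructureSelmer, §1.5.1 (PDF p. 7), Def. 2.13 (PDF p. 14)] -/
theorem levelCertificate_of_partialInfty_le :
    ∀ (W : WeierstrassCurve ℚ) [W.IsGloballyMinimal] (p : ℕ) [Fact p.Prime] {N : ℕ}
      (f : CuspForm (Gamma0 N) 2) (t : ℕ),
      kuriharaPartialInfty W p f ≤ (t : ℕ∞) →
      ∃ (k n : ℕ) (_ : NeZero n), 1 ≤ k ∧ k ≤ t + 1 ∧ Kato.IsKolyvaginProduct W p k n ∧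
        (∀ (ℓ : ℕ) [Fact ℓ.Prime], ℓ ∣ n →
          Nat.card {P : ((WeierstrassCurve.integralModelInt W).map
              (Int.castRingHom (ZMod ℓ))).toAffine.Point // p • P = 0} ≤ p) ∧
        ∃ ψ : (ℓ : ℕ) → (ZMod ℓ)ˣ →* Multiplicative (ZMod (p ^ k)),
          (∀ ℓ ∈ n.primeFactors, Function.Surjective (ψ ℓ)) ∧
            kuriharaNumber f (p ^ k) n ψ ≠ 0 :=
  Summit.BirchSwinnertonDyer.BirchSwinnertonDyer.Theorems.PrintX6.KimDeficit.stub_levelCertificate_of_partialInfty_le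

/-- STUB 2 (ENGINE; REGISTERED, formally open as typed — closers modulo named facts LANDED: p608837 `…_of_facts`,
p610149 `missingLowerBoundAt_of_levelCertificate_X6_of_kimTwin` / `…_of_publishedInputsX6_of_kimTwin`, Manin supply p609432;
published, refereed inputs only; closable modulo the NAMED facts Kim 2026 Thm. 1.8 (6)
`Kim2026.rankZero_le_padicValNat_sha_of_kuriharaNumber_ne_zero`, GZK `rank_eq_analyticRank_of_analyticRank_le_one`,
modularity `exists_isNewformOf` / `hasEntireLFunction_rat`, the period transfer `realPeriodRat_eq_unit_mul_plusPeriod`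
and a modular parametrisation datum `nonempty_modularParametrizationData_of_eichlerShimura`, through the tree
theorem `X4.missingLowerBoundAt_rankZero_of_kimLower`): on X6 ∧ `p ≥ 5` ∧ `r_an = 0`, a Kurihara certificate of
level `k ≤ ord_p ∏ c_ℓ + 1` for the newform of `W` gives the LOWER half `ord_p #Ш_an ≤ ord_p #Ш`
(`Typed.MissingLowerBoundAt W p`): `#Ш_an = (L(E,1)/Ω_E)·#T²/∏c_ℓ`, `p ∤ #T` (surj ⇒ irreducible),
`Ω_E = u·Ω⁺_f` with `|u|_p = 1`, `p ∤ c_D` (good `p ≥ 5`), so `ord_p #Ш_an = ord_p(L(E,1)/Ω⁺_f) − ord_p ∏c_ℓ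
≤ ord_p #Ш(p) + (k − 1) − ord_p ∏ c_ℓ ≤ ord_p #Ш`.
[cite: Kim2022StructureSelmer, Thm. 1.9 (6) (PDF p. 8) and §1.5.1–1.5.3 (PDF pp. 7–8)] [cite: Miller2011LMS, Def. 1.1] -/
theorem stub_missingLowerBoundAt_of_levelCertificate_X6 :
    ∀ (W : WeierstrassCurve ℚ) [W.IsElliptic] [W.IsGloballyMinimal] (p : ℕ) [Fact p.Prime],
      5 ≤ p → ClassX6 W p → W.analyticRank = 0 →
      (∀ [NeZero (W.conductorNorm ℤ)] (f : CuspForm (Gamma0 (W.conductorNorm ℤ)) 2), IsNewformOf W f →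
        ∃ (k n : ℕ) (_ : NeZero n), 1 ≤ k ∧ k ≤ padicValNat p W.tamagawaProduct + 1 ∧
          Kato.IsKolyvaginProduct W p k n ∧
          (∀ (ℓ : ℕ) [Fact ℓ.Prime], ℓ ∣ n →
            Nat.card {P : ((WeierstrassCurve.integralModelInt W).map
                (Int.castRingHom (ZMod ℓ))).toAffine.Point // p • P = 0} ≤ p) ∧
          ∃ ψ : (ℓ : ℕ) → (ZMod ℓ)ˣ →* Multiplicative (ZMod (p ^ k)),
            (∀ ℓ ∈ n.primeFactors, Function.Surjective (ψ ℓ)) ∧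
              kuriharaNumber f (p ^ k) n ψ ≠ 0) →
      MissingLowerBoundAt W p := by
  sorry

/-- STUB 3 — THE HARD STUB (class-wide, OPEN; the single input of the near-miss): on X6 (good supersingular
`p`, semistable) ∧ ¬CM ∧ `p ≥ 5` ∧ `r_an = 0` OFF the erratum sub-locus (every non-split multiplicative prime
`q` has `p ∣ ord_q Δ`), the `p`-divisibility of the Kurihara numbers of the newform `f` of `W` does not exceed
the Tamagawa exponent: `∂^(∞)(δ̃) ≤ t = ord_p ∏ c_ℓ`, i.e. SOME cyclic Kolyvagin level of depth `t + 1`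
carries `δ̃_n ≢ 0 (mod p^{t+1})` — the `≤` half of Kim's Conjecture 1.9 (arXiv Conj. 1.10) on this class
(the `≥` half is the Euler-system direction).  For rank `0` every single-prime Kurihara number vanishes
(functional equation), so the cheapest carriers are two-prime levels `ℓ₁ℓ₂ ∈ 𝒩_{t+1}`.  Per pair DECIDABLE
(exact plus modular symbols); class-wide it is equivalent, by Kim's Thm. 1.8 (6) read as an equality, to the
crux itself and, by Kim Thm. 1.11 / Castella–Sano, to Kato's main conjecture for these curves — the honest price.
[cite: Kim2022StructureSelmer, Conj. 1.10 and §1.5.3 (PDF p. 8), Thm. 1.11 (PDF p. 8)] -/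
theorem stub_partialInfty_le_tamagawa_X6Rest :
    ∀ (W : WeierstrassCurve ℚ) [W.IsElliptic] [W.IsGloballyMinimal] (p : ℕ) [Fact p.Prime],
      ¬ W.HasCM → 5 ≤ p → ClassX6 W p → W.analyticRank = 0 → ¬ HasErratumPrime W p →
      ∀ [NeZero (W.conductorNorm ℤ)] (f : CuspForm (Gamma0 (W.conductorNorm ℤ)) 2), IsNewformOf W f →
        kuriharaPartialInfty W p f ≤ (padicValNat p W.tamagawaProduct : ℕ∞) := by
  sorry

/-! ### The composition (no `sorry`) -/

/-- **The three stub statements give the crux `PrintX6.EisensteinHalfFiveLeRest` by name.**  Per pair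
`(W, p)` on X6-Rest ∧ `r_an = 0` ∧ `p ≥ 5`: stub 3 bounds `∂^(∞)(δ̃)` by `t = ord_p ∏ c_ℓ`, stub 1 turns the
bound into a level-`≤ t+1` certificate, stub 2 turns the certificate into `Typed.MissingLowerBoundAt W p`, whose
rational value of `#Ш_an` is the crux's `q` by injectivity of `ℚ → ℂ`. [folklore] -/
theorem EisensteinHalfFiveLeRest_of :
    (∀ (W : WeierstrassCurve ℚ) [W.IsGloballyMinimal] (p : ℕ) [Fact p.Prime] {N : ℕ}
      (f : CuspForm (Gamma0 N) 2) (t : ℕ),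
      kuriharaPartialInfty W p f ≤ (t : ℕ∞) →
      ∃ (k n : ℕ) (_ : NeZero n), 1 ≤ k ∧ k ≤ t + 1 ∧ Kato.IsKolyvaginProduct W p k n ∧
        (∀ (ℓ : ℕ) [Fact ℓ.Prime], ℓ ∣ n →
          Nat.card {P : ((WeierstrassCurve.integralModelInt W).map
              (Int.castRingHom (ZMod ℓ))).toAffine.Point // p • P = 0} ≤ p) ∧
        ∃ ψ : (ℓ : ℕ) → (ZMod ℓ)ˣ →* Multiplicative (ZMod (p ^ k)),
          (∀ ℓ ∈ n.primeFactors, Function.Surjective (ψ ℓ)) ∧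
            kuriharaNumber f (p ^ k) n ψ ≠ 0) →
    (∀ (W : WeierstrassCurve ℚ) [W.IsElliptic] [W.IsGloballyMinimal] (p : ℕ) [Fact p.Prime],
      5 ≤ p → ClassX6 W p → W.analyticRank = 0 →
      (∀ [NeZero (W.conductorNorm ℤ)] (f : CuspForm (Gamma0 (W.conductorNorm ℤ)) 2), IsNewformOf W f →
        ∃ (k n : ℕ) (_ : NeZero n), 1 ≤ k ∧ k ≤ padicValNat p W.tamagawaProduct + 1 ∧
          Kato.IsKolyvaginProduct W p k n ∧
          (∀ (ℓ : ℕ) [Fact ℓ.Prime], ℓ ∣ n →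
            Nat.card {P : ((WeierstrassCurve.integralModelInt W).map
                (Int.castRingHom (ZMod ℓ))).toAffine.Point // p • P = 0} ≤ p) ∧
          ∃ ψ : (ℓ : ℕ) → (ZMod ℓ)ˣ →* Multiplicative (ZMod (p ^ k)),
            (∀ ℓ ∈ n.primeFactors, Function.Surjective (ψ ℓ)) ∧
              kuriharaNumber f (p ^ k) n ψ ≠ 0) →
      MissingLowerBoundAt W p) →
    (∀ (W : WeierstrassCurve ℚ) [W.IsElliptic] [W.IsGloballyMinimal] (p : ℕ) [Fact p.Prime],
      ¬ W.HasCM → 5 ≤ p → ClassX6 W p → W.analyticRank = 0 → ¬ HasErratumPrime W p →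
      ∀ [NeZero (W.conductorNorm ℤ)] (f : CuspForm (Gamma0 (W.conductorNorm ℤ)) 2), IsNewformOf W f →
        kuriharaPartialInfty W p f ≤ (padicValNat p W.tamagawaProduct : ℕ∞)) →
    Summit.BirchSwinnertonDyer.BirchSwinnertonDyer.Theses.PrintX6.EisensteinHalfFiveLeRest := by
  intro h₁ h₂ h₃ W _ _ p _ hCM hp5 hX hr0 hRest q hq _hvq
  have hlow : MissingLowerBoundAt W p := by
    refine h₂ W p hp5 hX hr0 ?_
    intro _ f hf
    exact h₁ W p f (padicValNat p W.tamagawaProduct) (h₃ W p hCM hp5 hX hr0 hRest f hf)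
  obtain ⟨q', hq', hle⟩ := hlow
  have hqq : q = q' := by exact_mod_cast hq.symm.trans hq'
  subst hqq
  exact hle

/-- The stubs, applied: the landed stub 1 (`levelCertificate_of_partialInfty_le`) and the registered stubs 2–3 are
literally the three hypotheses of `EisensteinHalfFiveLeRest_of` (kernel check of the skeleton's shape; depends on the
two remaining `sorry`s and on nothing else). [folklore] -/
theorem EisensteinHalfFiveLeRest_of_stubs :
    Summit.BirchSwinnertonDyer.BirchSwinnertonDyer.Theses.PrintX6.EisensteinHalfFiveLeRest :=
  EisensteinHalfFiveLeRest_of levelCertificate_of_partialInfty_le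
    stub_missingLowerBoundAt_of_levelCertificate_X6 stub_partialInfty_le_tamagawa_X6Rest

end Summit.BirchSwinnertonDyer.BirchSwinnertonDyer.Cruxes.EisensteinHalfFiveLeRest.KimDeficit

end
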